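import Mathlib.Data.Nat.Bitwise
import Mathlib.Data.List.GetD
import Literature.NumberTheory.Transcendental.LinEDS
import HarnessLib

/-!
# `LinEDS`: codes of binary words — the bijection `{0,1}^L ≃ [0, 2^L)` and its basic API

Lemmas about `LinEDS.code`, `LinEDS.icode`, `LinEDS.wordOfCode`, `LinEDS.pre` of
`Literature/NumberTheory/Transcendental/LinEDS.lean` (the kernel-checkable GF(2) rank engine for the
linearised extended double shuffle system): bits of a code are the letters read from the end,
injectivity on words of a fixed length, the inverse `wordOfCode`, codes of concatenations, the link
`icode s = code (binaryWord s)` with `MZV.binaryWord`, and the bits of the letter-prepending shift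
`pre`. Shared by the soundness files `LinEDS*`. Everything here is elementary. [folklore]
-/

namespace Literature.NumberTheory.Transcendental

namespace LinEDS

/-- The empty word has code `0`. [folklore] -/
theorem code_nil : code [] = 0 := rfl

/-- Unfolding `code` on a nonempty word: the first letter is the most significant bit. [folklore] -/
theorem code_cons (b : Bool) (w : List Bool) : code (b :: w) = b.toNat * 2 ^ w.length + code w := rfl

/-- `code w < 2^|w|`. [folklore] -/
theorem code_lt : ∀ w : List Bool, code w < 2 ^ w.length
  | [] => by simp [code]
  | b :: w => by
    have := code_lt w
    simp only [code, List.length_cons, Nat.pow_succ]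
    cases b <;> simp <;> omega

/-- Bit `i` of `code w` is the `i`-th letter of `w` from the END. [folklore] -/
theorem testBit_code : ∀ (w : List Bool) (i : ℕ), (code w).testBit i = w.reverse.getD i false
  | [], i => by simp [code]
  | b :: w, i => by
    rw [code_cons, Nat.mul_comm, Nat.testBit_two_pow_mul_add _ (code_lt w), List.reverse_cons]
    by_cases hi : i < w.length
    · rw [if_pos hi, testBit_code w i, List.getD_append _ _ _ _ (by simpa using hi)]
    · rw [if_neg hi, List.getD_append_right _ _ _ _ (by simpa using Nat.le_of_not_lt hi)]
      simp only [List.length_reverse, Nat.testBit_bool_toNat]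
      rcases Nat.eq_or_lt_of_le (Nat.le_of_not_lt hi) with h | h
      · subst h; simp
      · have : i - w.length ≠ 0 := by omega
        simp [this, List.getD_eq_getElem?_getD]

/-- Bits of `code w` at positions `≥ |w|` vanish. [folklore] -/
theorem testBit_code_of_le {w : List Bool} {i : ℕ} (hi : w.length ≤ i) : (code w).testBit i = false :=
  Nat.testBit_eq_false_of_lt (lt_of_lt_of_le (code_lt w) (Nat.pow_le_pow_right (by norm_num) hi))

/-- Words of equal length with equal codes are equal. [folklore] -/
theorem code_injective {w w' : List Bool} (hl : w.length = w'.length) (hc : code w = code w') :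
    w = w' := by
  have key : ∀ i, w.reverse.getD i false = w'.reverse.getD i false := fun i => by
    rw [← testBit_code, ← testBit_code, hc]
  rw [← List.reverse_inj]
  refine List.ext_getElem (by simpa using hl) fun i h1 h2 => ?_
  have := key i
  rwa [List.getD_eq_getElem?_getD, List.getD_eq_getElem?_getD, List.getElem?_eq_getElem h1,
    List.getElem?_eq_getElem h2, Option.getD_some, Option.getD_some] at this

/-- `wordOfCode L c` has length `L`. [folklore] -/
theorem length_wordOfCode (L c : ℕ) : (wordOfCode L c).length = L := by simp [wordOfCode]

/-- The letters of `wordOfCode` from the end are the bits. [folklore] -/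
theorem wordOfCode_reverse_getD (L c i : ℕ) :
    (wordOfCode L c).reverse.getD i false = (decide (i < L) && c.testBit i) := by
  simp only [wordOfCode, List.reverse_reverse, List.getD_eq_getElem?_getD, List.getElem?_map]
  by_cases hi : i < L
  · simp [hi]
  · simp [hi]

/-- `code (wordOfCode L c) = c` for `c < 2^L`. [folklore] -/
theorem code_wordOfCode {L c : ℕ} (hc : c < 2 ^ L) : code (wordOfCode L c) = c := by
  apply Nat.eq_of_testBit_eq
  intro i
  rw [testBit_code, wordOfCode_reverse_getD]
  by_cases hi : i < L
  · simp [hi]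
  · simp [hi, Nat.testBit_eq_false_of_lt (lt_of_lt_of_le hc (Nat.pow_le_pow_right (by norm_num) (Nat.le_of_not_lt hi)))]

/-- `wordOfCode |w| (code w) = w`. [folklore] -/
theorem wordOfCode_code (w : List Bool) : wordOfCode w.length (code w) = w :=
  code_injective (length_wordOfCode _ _) (code_wordOfCode (code_lt w))

/-- `code (u ++ v) = code u · 2^|v| + code v`. [folklore] -/
theorem code_append : ∀ u v : List Bool, code (u ++ v) = code u * 2 ^ v.length + code v
  | [], v => by simp [code]
  | b :: u, v => by
    rw [List.cons_append, code_cons, code_cons, code_append u v, List.length_append, pow_add]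
    ring

/-- A word of `x`'s has code `0`. [folklore] -/
theorem code_replicate_false : ∀ m : ℕ, code (List.replicate m false) = 0
  | 0 => rfl
  | m + 1 => by rw [List.replicate_succ, code_cons, code_replicate_false m]; simp

/-- `icode s = code (binaryWord s)` for indices with positive entries. [folklore] -/
theorem icode_eq_code_binaryWord : ∀ {s : List ℕ}, (∀ a ∈ s, 1 ≤ a) →
    icode s = code (MZV.binaryWord s)
  | [], _ => rfl
  | a :: s, h => by
    have hs : ∀ b ∈ s, 1 ≤ b := fun b hb => h b (by simp [hb])
    rw [icode, MZV.binaryWord, code_append, code_append, code_replicate_false,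
      icode_eq_code_binaryWord hs, MZV.length_binaryWord hs]
    simp [code, MZV.weight]

/-- `icode s < 2^(weight s)` for positive entries. [folklore] -/
theorem icode_lt {s : List ℕ} (hs : ∀ a ∈ s, 1 ≤ a) : icode s < 2 ^ s.sum := by
  rw [icode_eq_code_binaryWord hs, ← MZV.weight, ← MZV.length_binaryWord hs]
  exact code_lt _

/-- Bits of `pre`: prepending `y` shifts the codes of length-`m` words by `2^m`. [folklore] -/
theorem testBit_pre (b : Bool) (m S i : ℕ) :
    (pre b m S).testBit i = if b then decide (2 ^ m ≤ i) && S.testBit (i - 2 ^ m) else S.testBit i := by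
  cases b <;> simp [pre, Nat.testBit_shiftLeft]


/-- `lengthTR` is `List.length`. [folklore] -/
theorem lengthTR_eq_length {α : Type*} (l : List α) : lengthTR l = l.length := by
  unfold lengthTR
  suffices h : ∀ n : ℕ, l.foldl (fun n _ => n + 1) n = n + l.length by simp [h 0]
  induction l with
  | nil => intro n; simp
  | cons a l ih => intro n; simp only [List.foldl_cons, ih, List.length_cons]; omega

/-- `sameLength l l'` decides `|l| = |l'|`. [folklore] -/
theorem sameLength_eq_true_iff {α β : Type*} :
    ∀ (l : List α) (l' : List β), sameLength l l' = true ↔ l.length = l'.length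
  | [], [] => by simp [sameLength]
  | [], _ :: _ => by simp [sameLength]
  | _ :: _, [] => by simp [sameLength]
  | _ :: l, _ :: l' => by simp [sameLength, sameLength_eq_true_iff l l']

end LinEDS

end Literature.NumberTheory.Transcendental
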